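import Literature.NumberTheory.Sieve.IwaniecAlmostPrimesProp2Prep
import Literature.NumberTheory.Sieve.PolynomialCongruencesMeanValues
import HarnessLib

/-!
# Iwaniec (1978), §4: the Corollary of Proposition 1 from Proposition 1 — PROVED

H. Iwaniec, *Almost-primes represented by quadratic polynomials*, Invent. Math. **47** (1978)
171–188, p. 176 [cite: IwaniecInventiones1978, Corollary p. 176]: "Corollary. For any `ε > 0`
we have `∑_{m<x^{1−4ε}} |∑_{n<x^{1/15−ε}, (n,m)=1} b_n r(𝒜; mn)| ≪ x^{1−ε}`, the implied constant
depending on `ε`.  Proof of Corollary. Letting `N = x^{1/15−ε}` it is sufficient to proof that for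
all `M < x^{1−4ε}`  `∑_{M<m<2M} |B(x; m, N)| ≪ x^{1−3ε/2}`.  If `M < x^{14/15−ε}` the result follows
from the trivial estimate `|B(x; m, N)| ≤ ρ(m) ∑_{n<N} ρ(n) ≪ ρ(m) N`.  If `x^{14/15−ε} ≤ M < x^{1−4ε}`,
by Proposition 1 and the Cauchy-Schwarz inequality we get
`∑_{M<m<2M} |B(x; m, N)| ≪ {(Mx)^{1/2} + N^{7/4} M^{−1/8} x} x^{ε/8} ≪ x^{1−3ε/2}`."  (In the last
display Proposition 1 is used with `ε/4` in place of `ε`; below it is used with `ε` itself, which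
gives `x^{1−9ε/8}` per dyadic class — any saving beyond `x^{1−ε}` suffices.)

This file PROVES `proposition1_corollary_of : proposition1 → proposition1_corollary` (both named
facts of `IwaniecAlmostPrimes.lean`), i.e. it removes the Corollary from the list of named inputs of
parity.S19: after it, `Literature.NumberTheory.Sieve.setOf_isAtMostAlmostPrime_two_sq_add_one_infinite` rests on
`lemma2_bilinearSieve` (Acta Arith. 37 (1980), Theorem 1) and `proposition1` (the dispersion
estimate, ⇐ a corrected Lemma 4 ⇐ Lemmas 5–7, Lemma 6 = Hooley's Weil-type bound).

The proof here (p. 176 made explicit).  Put `N = x^{1/15−ε}`, `D = x^{1−4ε}`, `t = max(2, x^{14/15−ε})`.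
* `m < t` (the "trivial estimate"): `|r(𝒜; d)| ≤ ρ(d)` (`abs_rem_le_rho`: on any `d` consecutive
  integers `n² + 1 ≡ 0 (mod d)` has exactly `ρ(d)` solutions), so by multiplicativity
  `∑_{m<t} |B(x; m, N)| ≤ (∑_{m≤t} ρ(m))(∑_{n≤N} ρ(n)) ≤ C_ρ² (x^{14/15−ε} + 2)(x^{1/15−ε} + 2) ≤ 9C_ρ² x^{1−ε}`
  (`∑_{m≤y} ρ(m) ≤ C_ρ y`, the tree's `Literature.NumberTheory.Sieve.exists_sum_rootCount_le` for `X² + 1`);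
* `t ≤ m < D`: group `m` by `i = ⌊log₂ m⌋` (`1 ≤ i ≤ ⌊log₂ x⌋ ≤ 2 log x` classes); the class lies in
  Proposition 1's range `M < m < 2M` with `M = 2^i − 1/4` (`x^{14/15−ε}/4 ≤ M ≤ D < x`), so by
  Cauchy's inequality and Proposition 1 (with its `ε` equal to ours)
  `(∑_class |B|)² ≤ 3M · C₁(1 + N^{7/2} M^{−5/4} x) x^{1+ε} ≤ 3C₁ x^{2−3ε} + 12 C₁ x^{2−9ε/4} ≤ 16 C₁ x^{2−9ε/4}`,
  whence the second part is `≤ 2 log x · 4√C₁ x^{1−9ε/8} ≤ (64/ε)√C₁ x^{1−ε}`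
  (`log x ≤ (8/ε) x^{ε/8}`).
For `ε ≥ 1/15` the range `n < x^{1/15−ε}` is empty and the Corollary is trivial.  (The exponent
`1/15` is exactly what balances `N^{7/2} M^{−1/4} x^{2}` at `M = x/N` against `x²`:
`N^{15/4} = x^{1/4}`.)

## References

* H. Iwaniec, Invent. Math. 47 (1978) 171–188, Proposition 1 and its Corollary, p. 176
  (`IwaniecInventiones1978`).
-/

open Finset Real Polynomial

noncomputable section

namespace Literature.NumberTheory.Sieve.Iwaniec1978

/-! ### The trivial bound `|r(𝒜; d)| ≤ ρ(d)` -/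

/-- On any `d` consecutive integers the congruence `n² + 1 ≡ 0 (mod d)` has exactly `ρ(d)`
solutions. [folklore] -/
theorem card_filter_Ico_dvd_sq_add_one (d a : ℕ) :
    ((Finset.Ico a (a + d)).filter fun n : ℕ => d ∣ n ^ 2 + 1).card = rho d := by
  have hper : Function.Periodic (fun n : ℕ => d ∣ n ^ 2 + 1) d := by
    intro n
    have e : (n + d) ^ 2 + 1 = d * (2 * n + d) + (n ^ 2 + 1) := by ring
    simp only [e, eq_iff_iff]
    exact Nat.dvd_add_right (dvd_mul_right d _)
  rw [Nat.filter_Ico_card_eq_of_periodic a d _ hper, Nat.count_eq_card_filter_range]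
  rfl

/-- `q` full periods starting at `1` contain exactly `q ρ(d)` solutions. [folklore] -/
theorem card_filter_Ico_one_dvd_sq_add_one (d q : ℕ) :
    ((Finset.Ico 1 (1 + q * d)).filter fun n : ℕ => d ∣ n ^ 2 + 1).card = q * rho d := by
  induction q with
  | zero => simp
  | succ q ih =>
    have hsplit : Finset.Ico 1 (1 + (q + 1) * d) =
        Finset.Ico 1 (1 + q * d) ∪ Finset.Ico (1 + q * d) (1 + q * d + d) := by
      rw [Finset.Ico_union_Ico_eq_Ico (by omega) (by omega)]
      congr 1; ring
    rw [hsplit, Finset.filter_union,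
      Finset.card_union_of_disjoint
        (Finset.disjoint_filter_filter (Finset.Ico_disjoint_Ico_consecutive _ _ _)),
      ih, card_filter_Ico_dvd_sq_add_one]
    ring

/-- **The trivial estimate `|r(𝒜; d)| ≤ ρ(d)`** (`d ≥ 1`, `x ≥ 0`): `[1, x]` consists of `⌊x⌋/d`
full periods, each with exactly `ρ(d)` solutions of `n² + 1 ≡ 0 (mod d)`, and a partial one.
(p. 176: "trivial estimate".) [cite: IwaniecInventiones1978, §4 p. 176] -/
theorem abs_rem_le_rho {x : ℝ} (hx : 0 ≤ x) {d : ℕ} (hd : d ≠ 0) : |rem x d| ≤ rho d := by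
  unfold rem congrCount
  set X := ⌊x⌋₊ with hXdef
  set q := X / d with hq
  have hdpos : 0 < d := Nat.pos_of_ne_zero hd
  have hqd : d * q + X % d = X := Nat.div_add_mod X d
  have hmod : X % d < d := Nat.mod_lt X hdpos
  have hlow : q * rho d ≤ ((Finset.Icc 1 X).filter fun n : ℕ => d ∣ n ^ 2 + 1).card := by
    rw [← card_filter_Ico_one_dvd_sq_add_one d q]
    refine Finset.card_le_card (Finset.filter_subset_filter _ fun n hn => ?_)
    rw [Finset.mem_Ico] at hn
    rw [Finset.mem_Icc]
    constructor
    · exact hn.1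
    · have : q * d ≤ X := Nat.div_mul_le_self X d
      omega
  have hup : ((Finset.Icc 1 X).filter fun n : ℕ => d ∣ n ^ 2 + 1).card ≤ (q + 1) * rho d := by
    rw [← card_filter_Ico_one_dvd_sq_add_one d (q + 1)]
    refine Finset.card_le_card (Finset.filter_subset_filter _ fun n hn => ?_)
    rw [Finset.mem_Icc] at hn
    rw [Finset.mem_Ico]
    constructor
    · exact hn.1
    · have h3 : X < (q + 1) * d := by
        have : (q + 1) * d = d * q + d := by ring
        omega
      omega
  have hd0 : (0 : ℝ) < d := by exact_mod_cast hdpos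
  have h1 : (q : ℝ) * d ≤ x := by
    calc (q : ℝ) * d = ((q * d : ℕ) : ℝ) := by push_cast; ring
      _ ≤ X := by exact_mod_cast Nat.div_mul_le_self X d
      _ ≤ x := Nat.floor_le hx
  have h2 : x ≤ ((q : ℝ) + 1) * d := by
    have h3 : X + 1 ≤ (q + 1) * d := by
      have : (q + 1) * d = d * q + d := by ring
      omega
    calc x ≤ (X : ℝ) + 1 := (Nat.lt_floor_add_one x).le
      _ = ((X + 1 : ℕ) : ℝ) := by push_cast; ring
      _ ≤ (((q + 1) * d : ℕ) : ℝ) := by exact_mod_cast h3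
      _ = ((q : ℝ) + 1) * d := by push_cast; ring
  set c := ((Finset.Icc 1 X).filter fun n : ℕ => d ∣ n ^ 2 + 1).card with hc
  have hlow' : (q : ℝ) * rho d ≤ c := by exact_mod_cast hlow
  have hup' : (c : ℝ) ≤ ((q : ℝ) + 1) * rho d := by exact_mod_cast hup
  have hρ0 : (0 : ℝ) ≤ rho d := Nat.cast_nonneg _
  have hA : (rho d : ℝ) * x / d ≤ ((q : ℝ) + 1) * rho d := by
    rw [div_le_iff₀ hd0]
    calc (rho d : ℝ) * x ≤ rho d * (((q : ℝ) + 1) * d) := mul_le_mul_of_nonneg_left h2 hρ0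
      _ = _ := by ring
  have hB : (q : ℝ) * rho d ≤ (rho d : ℝ) * x / d := by
    rw [le_div_iff₀ hd0]
    calc (q : ℝ) * rho d * d = rho d * ((q : ℝ) * d) := by ring
      _ ≤ rho d * x := mul_le_mul_of_nonneg_left h1 hρ0
  rw [abs_le]
  constructor <;> linarith

/-- `|B(x; m, N)| ≤ ρ(m) ∑_{n<N} ρ(n)` for `|b_n| ≤ 1`, `m ≥ 1`, `x ≥ 0` (trivial estimate and
multiplicativity of `ρ`). [cite: IwaniecInventiones1978, §4 p. 176] -/
theorem abs_bilinearB_le {x : ℝ} (hx : 0 ≤ x) {b : ℕ → ℝ} (hb : ∀ n, |b n| ≤ 1) {m : ℕ}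
    (hm : m ≠ 0) (N : ℝ) :
    |bilinearB x b m N| ≤ (rho m : ℝ) * ∑ n ∈ Finset.Ico 1 ⌈N⌉₊, (rho n : ℝ) := by
  unfold bilinearB
  calc |∑ n ∈ (Finset.Ico 1 ⌈N⌉₊).filter (fun n : ℕ => n.Coprime m), b n * rem x (m * n)|
      ≤ ∑ n ∈ (Finset.Ico 1 ⌈N⌉₊).filter (fun n : ℕ => n.Coprime m), |b n * rem x (m * n)| :=
        Finset.abs_sum_le_sum_abs _ _
    _ ≤ ∑ n ∈ (Finset.Ico 1 ⌈N⌉₊).filter (fun n : ℕ => n.Coprime m), (rho m : ℝ) * rho n := by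
        refine Finset.sum_le_sum fun n hn => ?_
        simp only [Finset.mem_filter, Finset.mem_Ico] at hn
        have hn0 : n ≠ 0 := by omega
        rw [abs_mul]
        calc |b n| * |rem x (m * n)| ≤ 1 * (rho (m * n) : ℝ) :=
              mul_le_mul (hb n) (abs_rem_le_rho hx (mul_ne_zero hm hn0)) (abs_nonneg _)
                zero_le_one
          _ = (rho m : ℝ) * rho n := by
              rw [one_mul, rho_mul_of_coprime hm hn0 hn.2.symm]; push_cast; ring
    _ ≤ ∑ n ∈ Finset.Ico 1 ⌈N⌉₊, (rho m : ℝ) * rho n :=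
        Finset.sum_le_sum_of_subset_of_nonneg (Finset.filter_subset _ _)
          fun _ _ _ => by positivity
    _ = _ := by rw [Finset.mul_sum]

/-! ### One dyadic block: Cauchy's inequality and Proposition 1 -/

/-- **Cauchy's inequality on a block `M < m < 2M`**: if `∑ B² ≤ C₁(1 + N^{7/2}M^{−5/4}x)x^{1+ε}`
(Proposition 1) then `(∑ |B|)² ≤ 3C₁(M x^{1+ε} + N^{7/2} M^{−1/4} x · x^{1+ε})` (`M ≥ 1`; the
block has at most `⌈2M⌉ ≤ 3M` terms). [cite: IwaniecInventiones1978, §4 p. 176] -/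
theorem sq_sum_abs_bilinearB_le {C₁ ε x N M : ℝ} {b : ℕ → ℝ}
    (hP : ∑ m ∈ (Finset.Icc 1 ⌈2 * M⌉₊).filter (fun m : ℕ => M < m ∧ (m : ℝ) < 2 * M),
        bilinearB x b m N ^ 2 ≤ C₁ * (1 + N ^ (7 / 2 : ℝ) * M ^ (-(5 / 4 : ℝ)) * x) * x ^ (1 + ε))
    (hM : 1 ≤ M) :
    (∑ m ∈ (Finset.Icc 1 ⌈2 * M⌉₊).filter (fun m : ℕ => M < m ∧ (m : ℝ) < 2 * M),
        |bilinearB x b m N|) ^ 2 ≤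
      3 * C₁ * (M * x ^ (1 + ε) + N ^ (7 / 2 : ℝ) * M ^ (-(1 / 4 : ℝ)) * x * x ^ (1 + ε)) := by
  set R := (Finset.Icc 1 ⌈2 * M⌉₊).filter (fun m : ℕ => M < m ∧ (m : ℝ) < 2 * M) with hR
  have hM0 : 0 < M := by linarith
  have hcard : (R.card : ℝ) ≤ 3 * M := by
    calc (R.card : ℝ) ≤ ((Finset.Icc 1 ⌈2 * M⌉₊).card : ℝ) := by
          exact_mod_cast Finset.card_filter_le _ _
      _ = ⌈2 * M⌉₊ := by simp
      _ ≤ 2 * M + 1 := (Nat.ceil_lt_add_one (by linarith)).le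
      _ ≤ 3 * M := by linarith
  have hcs : (∑ m ∈ R, |bilinearB x b m N|) ^ 2 ≤ R.card * ∑ m ∈ R, |bilinearB x b m N| ^ 2 :=
    sq_sum_le_card_mul_sum_sq
  have hsq : ∑ m ∈ R, |bilinearB x b m N| ^ 2 = ∑ m ∈ R, bilinearB x b m N ^ 2 := by
    simp [sq_abs]
  have hS0 : 0 ≤ ∑ m ∈ R, bilinearB x b m N ^ 2 := Finset.sum_nonneg fun _ _ => sq_nonneg _
  have hpow : M * M ^ (-(5 / 4 : ℝ)) = M ^ (-(1 / 4 : ℝ)) := by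
    rw [show (-(1 / 4 : ℝ)) = 1 + -(5 / 4 : ℝ) by norm_num, Real.rpow_add hM0, Real.rpow_one]
  calc (∑ m ∈ R, |bilinearB x b m N|) ^ 2 ≤ R.card * ∑ m ∈ R, bilinearB x b m N ^ 2 := by
        rw [← hsq]; exact hcs
    _ ≤ (3 * M) * (C₁ * (1 + N ^ (7 / 2 : ℝ) * M ^ (-(5 / 4 : ℝ)) * x) * x ^ (1 + ε)) :=
        mul_le_mul hcard hP hS0 (by linarith)
    _ = 3 * C₁ * (M * x ^ (1 + ε) +
          N ^ (7 / 2 : ℝ) * (M * M ^ (-(5 / 4 : ℝ))) * x * x ^ (1 + ε)) := by ring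
    _ = _ := by rw [hpow]

/-- The size estimate of a block: for `x ≥ 2`, `0 < ε`, `N = x^{1/15−ε}`,
`x^{14/15−ε}/4 ≤ M ≤ x^{1−4ε}` and `C₁ ≥ 0`,
`3C₁(M x^{1+ε} + N^{7/2} M^{−1/4} x · x^{1+ε}) ≤ 16 C₁ x^{2 − 9ε/4}`. [folklore] -/
theorem block_size_le {C₁ ε x M : ℝ} (hC : 0 ≤ C₁) (hε : 0 < ε) (hx : 2 ≤ x)
    (hMl : x ^ (14 / 15 - ε) / 4 ≤ M) (hMu : M ≤ x ^ (1 - 4 * ε)) :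
    3 * C₁ * (M * x ^ (1 + ε) +
        (x ^ (1 / 15 - ε)) ^ (7 / 2 : ℝ) * M ^ (-(1 / 4 : ℝ)) * x * x ^ (1 + ε)) ≤
      16 * C₁ * x ^ (2 - 9 * ε / 4) := by
  have hx0 : 0 < x := by linarith
  have hx1 : 1 ≤ x := by linarith
  have hM0 : 0 < M := lt_of_lt_of_le (by positivity) hMl
  -- first term: `M x^{1+ε} ≤ x^{2−3ε} ≤ x^{2−9ε/4}`
  have h1 : M * x ^ (1 + ε) ≤ x ^ (2 - 9 * ε / 4) := by
    calc M * x ^ (1 + ε) ≤ x ^ (1 - 4 * ε) * x ^ (1 + ε) :=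
          mul_le_mul_of_nonneg_right hMu (by positivity)
      _ = x ^ (2 - 3 * ε) := by rw [← Real.rpow_add hx0]; congr 1; ring
      _ ≤ x ^ (2 - 9 * ε / 4) := Real.rpow_le_rpow_of_exponent_le hx1 (by linarith)
  -- second term: `N^{7/2} M^{-1/4} x^{2+ε} ≤ 4 x^{2 − 9ε/4}`
  have hN : (x ^ (1 / 15 - ε)) ^ (7 / 2 : ℝ) = x ^ ((1 / 15 - ε) * (7 / 2)) := by
    rw [← Real.rpow_mul hx0.le]
  have hMq : M ^ (-(1 / 4 : ℝ)) ≤ 4 * x ^ (-((14 / 15 - ε) / 4)) := by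
    have hq : M ^ (-(1 / 4 : ℝ)) ≤ (x ^ (14 / 15 - ε) / 4) ^ (-(1 / 4 : ℝ)) :=
      Real.rpow_le_rpow_of_nonpos (by positivity) hMl (by norm_num)
    refine hq.trans ?_
    rw [Real.div_rpow (by positivity) (by norm_num), ← Real.rpow_mul hx0.le]
    have h4 : 1 / 4 ≤ (4 : ℝ) ^ (-(1 / 4 : ℝ)) := by
      have h44 : (4 : ℝ) ^ (1 / 4 : ℝ) ≤ 4 := by
        calc (4 : ℝ) ^ (1 / 4 : ℝ) ≤ (4 : ℝ) ^ (1 : ℝ) :=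
              Real.rpow_le_rpow_of_exponent_le (by norm_num) (by norm_num)
          _ = 4 := Real.rpow_one 4
      have h4p : 0 < (4 : ℝ) ^ (1 / 4 : ℝ) := by positivity
      rw [Real.rpow_neg (by norm_num : (0 : ℝ) ≤ 4)]
      calc (1 / 4 : ℝ) = 4⁻¹ := by norm_num
        _ ≤ ((4 : ℝ) ^ (1 / 4 : ℝ))⁻¹ := inv_anti₀ h4p h44
    have h4' : 0 < (4 : ℝ) ^ (-(1 / 4 : ℝ)) := by positivity
    rw [div_le_iff₀ h4', show (14 / 15 - ε) * -(1 / 4 : ℝ) = -((14 / 15 - ε) / 4) by ring]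
    have hxp : 0 ≤ x ^ (-((14 / 15 - ε) / 4)) := by positivity
    nlinarith
  have h2 : (x ^ (1 / 15 - ε)) ^ (7 / 2 : ℝ) * M ^ (-(1 / 4 : ℝ)) * x * x ^ (1 + ε) ≤
      4 * x ^ (2 - 9 * ε / 4) := by
    rw [hN]
    have hx1' : x = x ^ (1 : ℝ) := (Real.rpow_one x).symm
    calc x ^ ((1 / 15 - ε) * (7 / 2)) * M ^ (-(1 / 4 : ℝ)) * x * x ^ (1 + ε)
        ≤ x ^ ((1 / 15 - ε) * (7 / 2)) * (4 * x ^ (-((14 / 15 - ε) / 4))) * x * x ^ (1 + ε) := by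
          gcongr
      _ = 4 * (x ^ ((1 / 15 - ε) * (7 / 2)) * x ^ (-((14 / 15 - ε) / 4)) * x *
            x ^ (1 + ε)) := by ring
      _ = 4 * (x ^ ((1 / 15 - ε) * (7 / 2)) * x ^ (-((14 / 15 - ε) / 4)) * x ^ (1 : ℝ) *
            x ^ (1 + ε)) := by rw [← hx1']
      _ = 4 * x ^ (2 - 9 * ε / 4) := by
          rw [← Real.rpow_add hx0, ← Real.rpow_add hx0, ← Real.rpow_add hx0]
          congr 2; ring
  have hx2 : 0 ≤ x ^ (2 - 9 * ε / 4) := by positivity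
  nlinarith [mul_le_mul_of_nonneg_left h1 hC, mul_le_mul_of_nonneg_left h2 hC]

/-! ### The Corollary from Proposition 1 -/

/-- `X² + 1 ∈ ℤ[X]` has positive degree. [folklore] -/
theorem natDegree_X_sq_add_one_pos : 0 < (X ^ 2 + 1 : ℤ[X]).natDegree := by
  have : (X ^ 2 + 1 : ℤ[X]).natDegree = 2 := by
    simpa using natDegree_X_pow_add_C (n := 2) (r := (1 : ℤ))
  omega

/-- `∑_{m ≤ y} ρ(m) ≤ C_ρ y` for `y ≥ 2` (the tree's mean value of `ρ_f` for `f = X² + 1`).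
[folklore] -/
theorem exists_sum_rho_le :
    ∃ C : ℝ, 0 < C ∧ ∀ y : ℝ, 2 ≤ y → ∑ m ∈ Finset.Icc 1 ⌊y⌋₊, (rho m : ℝ) ≤ C * y := by
  obtain ⟨C, hC0, hC⟩ :=
    Literature.NumberTheory.Sieve.exists_sum_rootCount_le irreducible_X_sq_add_one_int natDegree_X_sq_add_one_pos
  refine ⟨C, hC0, fun y hy => ?_⟩
  simpa only [rho_eq_polyRootCountMod] using hC y hy

/-- `Ico 1 ⌈u⌉ ⊆ Icc 1 ⌊max u 2⌋`. [folklore] -/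
theorem Ico_one_ceil_subset (u : ℝ) :
    Finset.Ico 1 ⌈u⌉₊ ⊆ Finset.Icc 1 ⌊max u 2⌋₊ := by
  intro n hn
  rw [Finset.mem_Ico] at hn
  rw [Finset.mem_Icc]
  refine ⟨hn.1, Nat.le_floor ?_⟩
  have : (n : ℝ) < u := Nat.lt_ceil.mp hn.2
  exact this.le.trans (le_max_left _ _)

set_option maxHeartbeats 800000 in
/-- **The Corollary of Proposition 1 from Proposition 1 — PROVED** (p. 176: "By Cauchy's
inequality and trivial estimate … one simply derives from Proposition 1 the Corollary").
[cite: IwaniecInventiones1978, Corollary p. 176] -/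
theorem proposition1_corollary_of (h1 : proposition1) : proposition1_corollary := by
  intro ε hε
  -- the degenerate case `ε ≥ 1/15`: the range `n < x^{1/15-ε} ≤ 1` is empty
  rcases le_or_gt (1 / 15) ε with hε15 | hε15
  · refine ⟨0, fun x b hx hb hbs => ?_⟩
    have hN : ⌈x ^ (1 / 15 - ε)⌉₊ ≤ 1 := by
      refine Nat.ceil_le.mpr ?_
      rw [Nat.cast_one]
      exact Real.rpow_le_one_of_one_le_of_nonpos (by linarith) (by linarith)
    have hB : ∀ m, bilinearB x b m (x ^ (1 / 15 - ε)) = 0 := fun m => by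
      unfold bilinearB
      refine Finset.sum_eq_zero fun n hn => ?_
      simp only [Finset.mem_filter, Finset.mem_Ico] at hn
      omega
    have h0 : ∑ m ∈ Finset.Ico 1 ⌈x ^ (1 - 4 * ε)⌉₊, |bilinearB x b m (x ^ (1 / 15 - ε))| = 0 :=
      Finset.sum_eq_zero fun m _ => by rw [hB m, abs_zero]
    rw [h0, zero_mul]
  obtain ⟨C₁, hC₁⟩ := h1 ε hε
  obtain ⟨Cρ, hCρ0, hCρ⟩ := exists_sum_rho_le
  set C₁' : ℝ := max C₁ 1 with hC₁'
  have hC₁'0 : 0 ≤ C₁' := le_trans zero_le_one (le_max_right _ _)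
  have hC₁le : C₁ ≤ C₁' := le_max_left _ _
  refine ⟨9 * Cρ ^ 2 + 64 / ε * Real.sqrt C₁', fun x b hx hb hbs => ?_⟩
  -- notation and basic sizes
  have hx0 : 0 < x := by linarith
  have hx1 : 1 ≤ x := by linarith
  set N : ℝ := x ^ (1 / 15 - ε) with hNdef
  set D : ℝ := x ^ (1 - 4 * ε) with hDdef
  set t : ℝ := max 2 (x ^ (14 / 15 - ε)) with htdef
  set K : ℕ := ⌈t⌉₊ with hKdef
  have hN1 : 1 ≤ N := Real.one_le_rpow hx1 (by linarith)
  have hDx : D ≤ x := by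
    calc D = x ^ (1 - 4 * ε) := rfl
      _ ≤ x ^ (1 : ℝ) := Real.rpow_le_rpow_of_exponent_le hx1 (by linarith)
      _ = x := Real.rpow_one x
  have ht2 : 2 ≤ t := le_max_left _ _
  have ht0 : 0 < t := by linarith
  have htK : t ≤ K := Nat.le_ceil t
  have hxe : (1 : ℝ) ≤ x ^ (1 - ε) := Real.one_le_rpow hx1 (by linarith)
  set S := Finset.Ico 1 ⌈D⌉₊ with hS
  set g : ℕ → ℝ := fun m => |bilinearB x b m N| with hg
  have hg0 : ∀ m, 0 ≤ g m := fun m => abs_nonneg _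
  rw [← Finset.sum_filter_add_sum_filter_not S (fun m : ℕ => m < K) g]
  -- ### Part 1: `m < K`, the trivial estimate
  have hρN : ∑ n ∈ Finset.Ico 1 ⌈N⌉₊, (rho n : ℝ) ≤ Cρ * (N + 2) := by
    calc ∑ n ∈ Finset.Ico 1 ⌈N⌉₊, (rho n : ℝ) ≤ ∑ n ∈ Finset.Icc 1 ⌊max N 2⌋₊, (rho n : ℝ) :=
          Finset.sum_le_sum_of_subset_of_nonneg (Ico_one_ceil_subset N)
            fun _ _ _ => Nat.cast_nonneg _
      _ ≤ Cρ * max N 2 := hCρ _ (le_max_right _ _)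
      _ ≤ Cρ * (N + 2) := by
          refine mul_le_mul_of_nonneg_left (max_le (by linarith) (by linarith)) hCρ0.le
  have hρt : ∑ m ∈ S.filter (fun m : ℕ => m < K), (rho m : ℝ) ≤ Cρ * t := by
    calc ∑ m ∈ S.filter (fun m : ℕ => m < K), (rho m : ℝ) ≤
          ∑ m ∈ Finset.Icc 1 ⌊t⌋₊, (rho m : ℝ) := by
          refine Finset.sum_le_sum_of_subset_of_nonneg (fun m hm => ?_) fun _ _ _ =>
            Nat.cast_nonneg _
          simp only [Finset.mem_filter, hS, Finset.mem_Ico] at hm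
          rw [Finset.mem_Icc]
          refine ⟨hm.1.1, Nat.le_floor ?_⟩
          exact (Nat.lt_ceil.mp hm.2).le
      _ ≤ Cρ * t := hCρ t ht2
  have hpart1 : ∑ m ∈ S.filter (fun m : ℕ => m < K), g m ≤ 9 * Cρ ^ 2 * x ^ (1 - ε) := by
    calc ∑ m ∈ S.filter (fun m : ℕ => m < K), g m
        ≤ ∑ m ∈ S.filter (fun m : ℕ => m < K),
            (rho m : ℝ) * ∑ n ∈ Finset.Ico 1 ⌈N⌉₊, (rho n : ℝ) := by
          refine Finset.sum_le_sum fun m hm => ?_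
          simp only [Finset.mem_filter, hS, Finset.mem_Ico] at hm
          exact abs_bilinearB_le hx0.le hb (by omega) N
      _ = (∑ m ∈ S.filter (fun m : ℕ => m < K), (rho m : ℝ)) *
            ∑ n ∈ Finset.Ico 1 ⌈N⌉₊, (rho n : ℝ) := by rw [Finset.sum_mul]
      _ ≤ (Cρ * t) * (Cρ * (N + 2)) :=
          mul_le_mul hρt hρN (Finset.sum_nonneg fun _ _ => Nat.cast_nonneg _) (by positivity)
      _ ≤ (Cρ * (x ^ (14 / 15 - ε) + 2)) * (Cρ * (N + 2)) := by
          have : t ≤ x ^ (14 / 15 - ε) + 2 :=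
            max_le (by linarith [Real.rpow_nonneg hx0.le (14 / 15 - ε)]) (by linarith)
          gcongr
      _ = Cρ ^ 2 * (x ^ (14 / 15 - ε) * N + 2 * x ^ (14 / 15 - ε) + 2 * N + 4) := by ring
      _ ≤ Cρ ^ 2 * (x ^ (1 - ε) + 2 * x ^ (1 - ε) + 2 * x ^ (1 - ε) + 4 * x ^ (1 - ε)) := by
          have e1 : x ^ (14 / 15 - ε) * N ≤ x ^ (1 - ε) := by
            rw [hNdef, ← Real.rpow_add hx0]
            exact Real.rpow_le_rpow_of_exponent_le hx1 (by linarith)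
          have e2 : x ^ (14 / 15 - ε) ≤ x ^ (1 - ε) :=
            Real.rpow_le_rpow_of_exponent_le hx1 (by linarith)
          have e3 : N ≤ x ^ (1 - ε) := Real.rpow_le_rpow_of_exponent_le hx1 (by linarith)
          have hC2 : 0 ≤ Cρ ^ 2 := sq_nonneg _
          refine mul_le_mul_of_nonneg_left ?_ hC2
          linarith
      _ = 9 * Cρ ^ 2 * x ^ (1 - ε) := by ring
  -- ### Part 2: `K ≤ m < D`, dyadic classes and Proposition 1
  set I : ℕ := ⌊Real.logb 2 x⌋₊ with hIdef
  have hI : (I : ℝ) ≤ 2 * Real.log x := floor_logb_le x hx1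
  set S₂ := S.filter (fun m : ℕ => ¬ m < K) with hS₂
  have hmemS₂ : ∀ m ∈ S₂, 1 ≤ m ∧ (m : ℝ) < D ∧ t ≤ m := by
    intro m hm
    simp only [hS₂, hS, Finset.mem_filter, Finset.mem_Ico, not_lt] at hm
    refine ⟨hm.1.1, Nat.lt_ceil.mp hm.1.2, htK.trans (by exact_mod_cast hm.2)⟩
  have hmaps : ∀ m ∈ S₂, Nat.log 2 m ∈ Finset.Icc 1 I := by
    intro m hm
    obtain ⟨hm1, hmD, htm⟩ := hmemS₂ m hm
    rw [Finset.mem_Icc]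
    constructor
    · refine Nat.log_pos (by norm_num) ?_
      have : (2 : ℝ) ≤ m := ht2.trans htm
      exact_mod_cast this
    · refine le_floor_logb_of_pow_le hx0 ?_
      have h2 : ((2 ^ Nat.log 2 m : ℕ) : ℝ) ≤ m := by
        exact_mod_cast Nat.pow_log_le_self 2 (by omega)
      push_cast at h2
      linarith
  rw [← Finset.sum_fiberwise_of_maps_to hmaps]
  -- the bound for one class
  have hclass : ∀ i ∈ Finset.Icc 1 I,
      ∑ m ∈ S₂.filter (fun m : ℕ => Nat.log 2 m = i), g m ≤
        4 * Real.sqrt C₁' * x ^ (1 - 9 * ε / 8) := by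
    intro i hi
    rw [Finset.mem_Icc] at hi
    have hbound0 : 0 ≤ 4 * Real.sqrt C₁' * x ^ (1 - 9 * ε / 8) := by positivity
    rcases (S₂.filter (fun m : ℕ => Nat.log 2 m = i)).eq_empty_or_nonempty with h0 | ⟨m₀, hm₀⟩
    · rw [h0, Finset.sum_empty]; exact hbound0
    rw [Finset.mem_filter] at hm₀
    obtain ⟨hm₀1, hm₀D, htm₀⟩ := hmemS₂ m₀ hm₀.1
    set M : ℝ := (2 : ℝ) ^ i - 1 / 4 with hMdef
    have h2i : (2 : ℝ) ≤ (2 : ℝ) ^ i := by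
      calc (2 : ℝ) = 2 ^ 1 := by norm_num
        _ ≤ 2 ^ i := pow_le_pow_right₀ (by norm_num) hi.1
    have hM1 : 1 ≤ M := by rw [hMdef]; linarith
    -- every `m` of the class satisfies `M < m < 2M`
    have hmem : ∀ m ∈ S₂.filter (fun m : ℕ => Nat.log 2 m = i), M < m ∧ (m : ℝ) < 2 * M := by
      intro m hm
      rw [Finset.mem_filter] at hm
      obtain ⟨hm1, -, -⟩ := hmemS₂ m hm.1
      have hlo : ((2 ^ Nat.log 2 m : ℕ) : ℝ) ≤ m := by
        exact_mod_cast Nat.pow_log_le_self 2 (by omega)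
      have hhi : ((m + 1 : ℕ) : ℝ) ≤ ((2 ^ (Nat.log 2 m + 1) : ℕ) : ℝ) := by
        exact_mod_cast Nat.lt_pow_succ_log_self (by norm_num) m
      rw [hm.2] at hlo hhi
      push_cast at hlo hhi
      constructor
      · rw [hMdef]; linarith
      · rw [hMdef]; linarith [pow_succ (2 : ℝ) i]
    have hMm₀ : M < m₀ := (hmem m₀ (Finset.mem_filter.mpr hm₀)).1
    have hm₀M : (m₀ : ℝ) < 2 * M := (hmem m₀ (Finset.mem_filter.mpr hm₀)).2
    have hMx : M < x := by linarith
    have hMD : M ≤ D := by linarith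
    have hMt : x ^ (14 / 15 - ε) / 4 ≤ M := by
      have : x ^ (14 / 15 - ε) ≤ t := le_max_right _ _
      linarith
    -- Proposition 1 on the block
    have hP := hC₁ x M N b hM1 hMx hN1 hb hbs
    have hP' : ∑ m ∈ (Finset.Icc 1 ⌈2 * M⌉₊).filter (fun m : ℕ => M < m ∧ (m : ℝ) < 2 * M),
        bilinearB x b m N ^ 2 ≤
          C₁' * (1 + N ^ (7 / 2 : ℝ) * M ^ (-(5 / 4 : ℝ)) * x) * x ^ (1 + ε) := by
      refine hP.trans (mul_le_mul_of_nonneg_right (mul_le_mul_of_nonneg_right hC₁le ?_) ?_)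
      · have : 0 ≤ N ^ (7 / 2 : ℝ) * M ^ (-(5 / 4 : ℝ)) * x := by positivity
        linarith
      · positivity
    have hblock := sq_sum_abs_bilinearB_le hP' hM1
    have hsize := block_size_le (M := M) hC₁'0 hε hx hMt hMD
    -- the class is contained in the block
    have hsub : S₂.filter (fun m : ℕ => Nat.log 2 m = i) ⊆
        (Finset.Icc 1 ⌈2 * M⌉₊).filter (fun m : ℕ => M < m ∧ (m : ℝ) < 2 * M) := by
      intro m hm
      have hb2 := hmem m hm
      rw [Finset.mem_filter] at hm
      obtain ⟨hm1, -, -⟩ := hmemS₂ m hm.1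
      rw [Finset.mem_filter, Finset.mem_Icc]
      refine ⟨⟨hm1, ?_⟩, hb2⟩
      have : (m : ℝ) ≤ ⌈2 * M⌉₊ := hb2.2.le.trans (Nat.le_ceil _)
      exact_mod_cast this
    have hle : ∑ m ∈ S₂.filter (fun m : ℕ => Nat.log 2 m = i), g m ≤
        ∑ m ∈ (Finset.Icc 1 ⌈2 * M⌉₊).filter (fun m : ℕ => M < m ∧ (m : ℝ) < 2 * M), g m :=
      Finset.sum_le_sum_of_subset_of_nonneg hsub fun _ _ _ => hg0 _
    refine hle.trans ?_
    -- take square roots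
    have hsq : (∑ m ∈ (Finset.Icc 1 ⌈2 * M⌉₊).filter (fun m : ℕ => M < m ∧ (m : ℝ) < 2 * M),
        g m) ^ 2 ≤ (4 * Real.sqrt C₁' * x ^ (1 - 9 * ε / 8)) ^ 2 := by
      calc _ ≤ 16 * C₁' * x ^ (2 - 9 * ε / 4) := hblock.trans hsize
        _ = (4 * Real.sqrt C₁' * x ^ (1 - 9 * ε / 8)) ^ 2 := by
            have e : (x ^ (1 - 9 * ε / 8)) ^ 2 = x ^ (2 - 9 * ε / 4) := by
              rw [← Real.rpow_natCast, ← Real.rpow_mul hx0.le]; congr 1; push_cast; ring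
            rw [mul_pow, mul_pow, Real.sq_sqrt hC₁'0, e]; ring
    exact (pow_le_pow_iff_left₀ (Finset.sum_nonneg fun _ _ => hg0 _) hbound0
      (by norm_num : (2 : ℕ) ≠ 0)).mp hsq
  have hpart2 : ∑ i ∈ Finset.Icc 1 I, ∑ m ∈ S₂.filter (fun m : ℕ => Nat.log 2 m = i), g m ≤
      64 / ε * Real.sqrt C₁' * x ^ (1 - ε) := by
    have hlog : Real.log x ≤ x ^ (ε / 8) / (ε / 8) :=
      Real.log_le_rpow_div hx0.le (by positivity)
    calc ∑ i ∈ Finset.Icc 1 I, ∑ m ∈ S₂.filter (fun m : ℕ => Nat.log 2 m = i), g m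
        ≤ ∑ i ∈ Finset.Icc 1 I, 4 * Real.sqrt C₁' * x ^ (1 - 9 * ε / 8) :=
          Finset.sum_le_sum hclass
      _ = I * (4 * Real.sqrt C₁' * x ^ (1 - 9 * ε / 8)) := by simp
      _ ≤ (2 * Real.log x) * (4 * Real.sqrt C₁' * x ^ (1 - 9 * ε / 8)) :=
          mul_le_mul_of_nonneg_right hI (by positivity)
      _ ≤ (2 * (x ^ (ε / 8) / (ε / 8))) * (4 * Real.sqrt C₁' * x ^ (1 - 9 * ε / 8)) := by
          gcongr
      _ = 64 / ε * Real.sqrt C₁' * (x ^ (ε / 8) * x ^ (1 - 9 * ε / 8)) := by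
          field_simp; ring
      _ = 64 / ε * Real.sqrt C₁' * x ^ (1 - ε) := by
          rw [← Real.rpow_add hx0]; congr 2; ring
  calc ∑ m ∈ S.filter (fun m : ℕ => m < K), g m +
        ∑ i ∈ Finset.Icc 1 I, ∑ m ∈ S₂.filter (fun m : ℕ => Nat.log 2 m = i), g m
      ≤ 9 * Cρ ^ 2 * x ^ (1 - ε) + 64 / ε * Real.sqrt C₁' * x ^ (1 - ε) :=
        add_le_add hpart1 hpart2
    _ = (9 * Cρ ^ 2 + 64 / ε * Real.sqrt C₁') * x ^ (1 - ε) := by ring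

end Literature.NumberTheory.Sieve.Iwaniec1978

end
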